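import Literature.IUT.HodgeArakelov.StableCurveAgreementInertiaOfPiV
import Literature.AnabelianGeometry.SemiGraphs.CosetCategoriesEquivalence
import Mathlib.Topology.Homeomorph.Lemmas
import HarnessLib

/-!
# [IUTchII] Def 2.3 (ii) / Rmk 2.3.1 input «`I ≅ Ẑ(1)`» at a genuine agreement: every `Π^±_v`-cuspidal inertia group of the cusp datum of
# an agreement with an [IUTchI] §2 datum `ofSpecialFibre Y …` is isomorphic, AS A TOPOLOGICAL GROUP, to `Ẑ`

S. Mochizuki, *Inter-universal Teichmüller Theory II*, kurims manuscript (Dec. 2020), §2, Def 2.3 (ii) p. 68 («the cuspidal inertia groups … [cf.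
[AbsTopI], Lemma 4.5]»), Rmk 2.3.1 p. 69 («`I ∩ Π_⊆ = I^l` — where the superscript `l` is relative to the group operation on `I`»: the input used is
`[I : I^l] = l`, i.e. `I ≅ Ẑ(1)`); [SemiAnbd] §6 p. 71 («`I_x := D_x ∩ Δ^temp_X` is isomorphic to `Ẑ(1)` if `x` is a cusp») [cite: Mochizuki2012, II Def 2.3 (ii)
p.68, Rmk 2.3.1 p.69] [cite: MochizukiSemiAnbd2006, §6 p.71].  abc-iut cell, zone [IUTchII] §2 (seat abc-iut-L6-t19 gen 6); PROOF-ONLY (no `def`).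
Sequel of `StableCurveAgreementInertiaOfPiV.lean` (p440804).

THE POINT.  abc-iut-L6-t19's `rmk231_powers_of_zHat` (p418082) takes the `Ẑ(1)`-shape of the `Π_⊇`-cuspidal inertia groups BY NAME as
`Nonempty (I ≃ₜ* Ẑ)`.  For the cusp datum `Cu` of a `StableCurveAgreement W Cu (ofSpecialFibre Y …)` (abc-iut-w5-d132's p430970 / p433029 /
p434636 at the genuine tower) the `Π^±_v`-cuspidal groups are the `emb ∘ φ⁻¹`-images of the `Π^tp_Y`-conjugates `t I_y t⁻¹` of the inertia groups
`I_y = D_y ∩ Δ^temp` of the cusps `y` of `Y`, and abc-iut-L3's interface FIELD `TemperedCurve.inertia_equiv_zHat` says `I_y ≃ₜ* Ẑ`.  This file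
transports that along conjugation (a homeomorphism), `φ⁻¹` (an isomorphism of topological groups) and `emb` (continuous injective; its restriction
to the COMPACT group `φ⁻¹(t I_y t⁻¹) ≅ Ẑ` is a homeomorphism onto its image in the Hausdorff `Π̂^cor_v`):

* **`PlusMinusTower.StableCurveAgreement.nonempty_equiv_zHat_of_isCuspidalInertia_piPM`** — for ANY tower `W` with `Π̂^cor_v` Hausdorff and `emb`
  continuous, ANY tempered curve `Y` with special-fibre data, ANY `A : StableCurveAgreement W Cu (ofSpecialFibre Y …)` with `A.eHat ∘ emb = toHat ∘ φ`
  for an isomorphism of topological groups `φ : Π^±_v(P) ≃ₜ* Π^tp_Y`: every `Π^±_v`-cuspidal `I` satisfies `Nonempty (I ≃ₜ* Ẑ)` — EXACTLY the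
  hypothesis `hZhat` of `rmk231_powers_of_zHat` / `isCuspidalInertia_map_conj_of_zHat` at `Q_⊇ = Π^±_v`.

HONEST LABEL: the `Ẑ`-shape itself is abc-iut-L3's interface field (quoted print), not proved here; this file is transport.  Nothing of the series is
asserted; no side taken on [IUTchIII] Cor 3.12.
-/

noncomputable section

namespace Literature.IUT.HodgeArakelov

open Literature.AnabelianGeometry.EtaleTheta Literature.AnabelianGeometry.SemiGraphs Literature.IUT.HodgeTheaters
open scoped Pointwise

namespace PlusMinusTower

section Transport

variable {G G' : Type*} [Group G] [TopologicalSpace G] [Group G'] [TopologicalSpace G']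

/-- The image of a subgroup under an isomorphism of topological groups is isomorphic to it as a topological group. [folklore] -/
private theorem nonempty_continuousMulEquiv_map_equiv (e : G ≃ₜ* G') (K : Subgroup G) :
    Nonempty (↥K ≃ₜ* ↥(K.map e.toMulEquiv.toMonoidHom)) := by
  refine ⟨{ e.toMulEquiv.subgroupMap K with continuous_toFun := ?_, continuous_invFun := ?_ }⟩
  · exact (e.continuous.comp continuous_subtype_val).subtype_mk _
  · exact (e.symm.continuous.comp continuous_subtype_val).subtype_mk _

end Transport

section ZHat

variable {S : BadPlaceSetting.{0}} {P : TopGroup.{0}} {T : TemperedCoverings S P}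
variable {p : ℕ} [Fact p.Prime] (Y : TemperedCurve p) (d : Y.GroupLevelData)
  (Sf : SpecialFibreData (Y.toTemperedArithmeticGroup d)) (h36 : Sf.Gc.Prop36Hypotheses)
  (Sigma SigmaHat : Set ℕ) (hsub : Sigma ⊆ SigmaHat) (hne : Sigma.Nonempty)
  (hprime : ∀ q ∈ SigmaHat, q.Prime) (hp : p ∉ Sigma) (TpH : Subgroup Sf.chart.G)
  (HatH : Subgroup (TemperedGraphGroupData.exists_completion_of_prop36 Sf.Gc h36 Sf.chart).choose)
  (hle : TpH.map (TemperedGraphGroupData.exists_completion_of_prop36 Sf.Gc h36 Sf.chart).choose_spec.choose.toMonoidHom ≤ HatH)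
  (cuspMeetsH : {x : Y.Pt // Y.IsCusp x} → Prop)

/-- The inertia group `I_y` of the datum `ofSpecialFibre Y …`, read in `Π^tp_Y`, IS `D_y ∩ Δ^temp_Y`. [cite: MochizukiSemiAnbd2006, §6 p.71] -/
theorem map_subtype_inertiaTp_ofSpecialFibre
    (y : (StableCurveTemperedData.ofSpecialFibre Y d Sf h36 Sigma SigmaHat hsub hne hprime hp TpH HatH hle cuspMeetsH).Cusp) :
    ((StableCurveTemperedData.ofSpecialFibre Y d Sf h36 Sigma SigmaHat hsub hne hprime hp TpH HatH hle cuspMeetsH).inertiaTp y).map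
        (StableCurveTemperedData.ofSpecialFibre Y d Sf h36 Sigma SigmaHat hsub hne hprime hp TpH HatH hle cuspMeetsH).DeltaTp.subtype =
      Y.decomp y.1 ⊓ Y.aug.toMonoidHom.ker := by
  ext w
  constructor
  · rintro ⟨u, hu, rfl⟩
    exact hu
  · intro hw
    have hker : w ∈ Y.augGK.toMonoidHom.ker := by
      rw [StableCurveTemperedData.OfSpecialFibre.ker_augGK_eq_deltaTemp]
      exact (Subgroup.mem_inf.mp hw).2
    exact ⟨⟨w, hker⟩, hw, rfl⟩

/-- **[IUTchII] Def 2.3 (ii) / Rmk 2.3.1 input «`I ≅ Ẑ(1)`» AT A GENUINE AGREEMENT.**  Let `W` be a `±`-tower with `Π̂^cor_v` Hausdorff and `emb`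
continuous, `A : StableCurveAgreement W Cu (ofSpecialFibre Y …)` an agreement with the [IUTchI] §2 datum of a tempered curve `Y` (any special-fibre
data), and `φ : Π^±_v(P) ≃ₜ* Π^tp_Y` an isomorphism of topological groups with `A.eHat ∘ emb = toHat ∘ φ`.  Then every cuspidal inertia group `I`
of `Π^±_v` (for `Cu`) is isomorphic to `Ẑ` as a topological group: `I = emb(φ⁻¹(t · I_y · t⁻¹))` for a cusp `y` of `Y` and `t ∈ Π^tp_Y`
(`A.inertia_iff`), `I_y ≃ₜ* Ẑ` (abc-iut-L3's interface field `inertia_equiv_zHat`), conjugation and `φ⁻¹` are isomorphisms of topological groups,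
and `emb` restricted to the compact `φ⁻¹(t I_y t⁻¹)` is a homeomorphism onto `I ⊆ Π̂^cor_v` (Hausdorff).  PROVED.  (= the hypothesis `hZhat` of
abc-iut-L6-t19's `rmk231_powers_of_zHat` at `Q_⊇ = Π^±_v`.)  ([IUTchII] Def 2.3 (ii) p.68, Rmk 2.3.1 p.69) [cite: Mochizuki2012, II Rmk 2.3.1 p.69]
[cite: MochizukiSemiAnbd2006, §6 p.71] [claim: Mochizuki2012, status: disputed] -/
theorem StableCurveAgreement.nonempty_equiv_zHat_of_isCuspidalInertia_piPM {W : PlusMinusTower T} [T2Space W.Corhat]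
    (hemb : Continuous W.emb) {Cu : CuspidalInertiaData W}
    (A : StableCurveAgreement W Cu
      (StableCurveTemperedData.ofSpecialFibre Y d Sf h36 Sigma SigmaHat hsub hne hprime hp TpH HatH hle cuspMeetsH))
    (φ : T.Xplain ≃ₜ* Y.PiTemp)
    (hA : ∀ w : T.Xplain, A.eHat ⟨W.emb w, W.emb_le_pmHat ⟨w, rfl⟩⟩ =
      (StableCurveTemperedData.ofSpecialFibre Y d Sf h36 Sigma SigmaHat hsub hne hprime hp TpH HatH hle cuspMeetsH).ιX (φ w))
    {I : Subgroup W.Corhat} (hI : Cu.IsCuspidalInertia W.piPM I) :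
    Nonempty (↥I ≃ₜ* Literature.AnabelianGeometry.SemiGraphs.ZHat) := by
  obtain ⟨hIle, y, t, hEq⟩ := (A.inertia_iff I).mp hI
  -- the subgroup `K = t · I_y · t⁻¹` of `Π^tp_Y` and its isomorphism with `Ẑ`
  rw [map_subtype_inertiaTp_ofSpecialFibre Y d Sf h36 Sigma SigmaHat hsub hne hprime hp TpH HatH hle cuspMeetsH y] at hEq
  obtain ⟨e₀⟩ := Y.inertia_equiv_zHat y.1 y.2
  obtain ⟨e₁⟩ := CosetCat.nonempty_continuousMulEquiv_conj (Y.decomp y.1 ⊓ Y.aug.toMonoidHom.ker) (t : Y.PiTemp)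
  set K : Subgroup Y.PiTemp := MulAut.conj (t : Y.PiTemp) • (Y.decomp y.1 ⊓ Y.aug.toMonoidHom.ker) with hKdef
  -- `eK : K ≃ₜ* Ẑ`
  let eK : ↥K ≃ₜ* Literature.AnabelianGeometry.SemiGraphs.ZHat := e₁.symm.trans e₀
  -- `K' = φ⁻¹(K) ≤ Π^±_v(P)`, isomorphic to `K`
  obtain ⟨e₂⟩ := nonempty_continuousMulEquiv_map_equiv φ.symm K
  set K' : Subgroup T.Xplain := K.map φ.symm.toMulEquiv.toMonoidHom with hK'def
  -- membership in `I`: `emb w ∈ I ↔ φ w ∈ K`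
  have hmem : ∀ w : T.Xplain, W.emb w ∈ I ↔ φ w ∈ K := fun w =>
    A.emb_mem_iff_of_map_eq (fun w => φ w) hA hEq w
  -- the group isomorphism `K' ≃* I`, `k ↦ emb k`
  have hwd : ∀ k : K', W.emb (k : T.Xplain) ∈ I := by
    rintro ⟨_, k₀, hk₀, rfl⟩
    refine (hmem _).mpr ?_
    change φ (φ.symm k₀) ∈ K
    rw [ContinuousMulEquiv.apply_symm_apply]
    exact hk₀
  let g : ↥K' →* ↥I :=
    { toFun := fun k => ⟨W.emb (k : T.Xplain), hwd k⟩
      map_one' := Subtype.ext (by simp)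
      map_mul' := fun a b => Subtype.ext (by simp) }
  have hg_inj : Function.Injective g := by
    intro a b hab
    apply Subtype.ext
    exact W.emb_injective (congrArg Subtype.val hab)
  have hg_surj : Function.Surjective g := by
    rintro ⟨i, hi⟩
    obtain ⟨w, rfl⟩ := hIle hi
    have hwK : φ w ∈ K := (hmem w).mp hi
    refine ⟨⟨w, ⟨φ w, hwK, ?_⟩⟩, rfl⟩
    change φ.symm (φ w) = w
    rw [ContinuousMulEquiv.symm_apply_apply]
  have hg_cont : Continuous g := (hemb.comp continuous_subtype_val).subtype_mk _
  -- `K'` is compact (`≅ Ẑ`) and `I ⊆ Π̂^cor_v` is Hausdorff: `g` is a homeomorphism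
  haveI : CompactSpace ↥K' := (e₂.symm.trans eK).toHomeomorph.symm.compactSpace
  let gE : ↥K' ≃ ↥I := Equiv.ofBijective g ⟨hg_inj, hg_surj⟩
  have hgE : Continuous gE := hg_cont
  let gH : ↥K' ≃ₜ ↥I := Continuous.homeoOfEquivCompactToT2 hgE
  let gM : ↥K' ≃ₜ* ↥I :=
    { MulEquiv.ofBijective g ⟨hg_inj, hg_surj⟩ with
      continuous_toFun := hg_cont
      continuous_invFun := gH.symm.continuous }
  exact ⟨(gM.symm.trans e₂.symm).trans eK⟩

end ZHat

end PlusMinusTower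

end Literature.IUT.HodgeArakelov

end
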